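import Literature.AnabelianGeometry.AbsoluteAnabelian.HolomorphicEllipticCuspidalizationProofs
import Literature.AnabelianGeometry.AbsoluteAnabelian.HolomorphicEllipticCuspidalizationDeck
import HarnessLib

/-!
# [AbsTopIII] Cor 2.7 (c) sub-DAG: density of the cuspidal torsion points at the model, ASSEMBLED

Proof-only assembly (theorems only, no new definitions) for the sub-DAG of [AbsTopIII] Corollary 2.7
(S. Mochizuki, *Topics in absolute anabelian geometry III*, kurims pp. 58–60, lit key
`paper:url-5493eb38cbb7`; statements `HolomorphicEllipticCuspidalization.lean` p414370, table
`plan/L4/SUBDAG-AbsTopIII-Cor-27.md`).  The six `[N]`-diagram sub-nodes (b).1–(b).6 and (c).1 are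
proved in the tree — (b).1 `nsmulCovIsFiniteEtale_holds` (abc-iut-w5-d226,
`HolomorphicEllipticCuspidalizationFiniteEtale.lean`), (b).3 `nsmulDeckAbelianTransitive_holds`
(abc-iut-w5-d226, `HolomorphicEllipticCuspidalizationDeck.lean`), (b).2/(b).4/(b).5/(b).6/(c).1
(abc-iut-L4-t12, `HolomorphicEllipticCuspidalizationProofs.lean`) — so the compositions of the
statements file apply unconditionally:

* `exists_nsmulDiagram` — the `[N]`-diagram `𝔼 ↩ 𝕌_N → 𝔼` (`N ≠ 0`) of the model punctured torus IS
  an elliptic cuspidalization diagram in the typed sense, its image missing exactly the non-zero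
  `N`-torsion points ("By considering 'elliptic cuspidalization diagrams' as in [Mzk21], Example 3.2",
  p. 59);
* `nsmul_mem_cuspidalTorsionPoints` — every non-zero torsion point of the torus is a cuspidal torsion
  point of `𝔼` (inclusion `⊇` of (b), unconditionally);
* **`cuspidalTorsionPointsDenseModel_holds`** — sub-node (c).2 `CuspidalTorsionPointsDenseModel`:
  the cuspidal torsion points of the model punctured torus are dense ("Since the torsion points of (b)
  are dense in `E^top`", p. 59), UNCONDITIONAL;
* `torsionPointsDenseUniqueGroupLaw_of_model_transport` — the named fact
  `TorsionPointsDenseUniqueGroupLaw` of Cor 2.7 (c) follows from the two remaining sub-nodes (c).4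
  `PuncturedEllipticCurveModel` (⇐ the uniformization of genus-one surfaces, Farkas–Kra IV.6.1 (c),
  sub-node (c).3) and (c).5 `CuspidalTorsionPointsTransport`.

HONEST FRAMING: OUR kernel check of a step of a statement of a refereed paper; nothing here bears on
the disputed [IUTchIII] Cor. 3.12.
-/

noncomputable section

namespace Literature.AnabelianGeometry.AbsoluteAnabelian

namespace HolomorphicEllipticCuspidalization

open _root_.TopologicalSpace _root_.Topology
open Literature.Geometry.Kaehler (ComplexTorus)

variable {ι : Type} [Fintype ι] (Φ : (ι → ℝ) ≃L[ℝ] ℂ)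

/-- The `[N]`-diagram `𝔼 ↩ 𝕌_N → 𝔼` (`N ≠ 0`) of the model punctured torus IS an elliptic
cuspidalization diagram in the typed sense (`EllipticCuspidalizationDiagram`), unconditionally, and the
points off the image of its open immersion are exactly the non-zero `N`-torsion points.
[cite: MochizukiAbsTopIII2015, Corollary 2.7 (b) p.59] -/
theorem exists_nsmulDiagram {N : ℕ} (hN : N ≠ 0) :
    ∃ D : EllipticCuspidalizationDiagram ↥(puncturedTorus Φ),
      ∀ x : puncturedTorus Φ, x ∉ Set.range D.imm ↔ N • (x : ComplexTorus Φ) = 0 :=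
  ⟨nsmulDiagram nsmulCovIsFiniteEtale_holds nsmulCovIsMorphism_holds nsmulDeckAbelianTransitive_holds
      nsmulImmIsMorphism_holds nsmulImmComplement_holds nsmulCoholomorphic_holds Φ N hN,
    fun x => (nsmulImmComplement_holds ι Φ N hN).2 x⟩

/-- Every non-zero `N`-torsion point (`N ≠ 0`) of the torus is a cuspidal torsion point of the model
punctured torus `𝔼` — the inclusion `⊇` of "one may construct the torsion points … as the points in the
complement of the image of such morphisms `U ↪ E`", unconditionally.
[cite: MochizukiAbsTopIII2015, Corollary 2.7 (b) p.59] -/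
theorem nsmul_mem_cuspidalTorsionPoints {N : ℕ} (hN : N ≠ 0) (x : puncturedTorus Φ)
    (hx : N • (x : ComplexTorus Φ) = 0) : x ∈ cuspidalTorsionPoints ↥(puncturedTorus Φ) :=
  mem_cuspidalTorsionPoints_of_nsmul_eq_zero nsmulCovIsFiniteEtale_holds nsmulCovIsMorphism_holds
    nsmulDeckAbelianTransitive_holds nsmulImmIsMorphism_holds nsmulImmComplement_holds
    nsmulCoholomorphic_holds Φ hN x hx

/-- **Sub-node (c).2 PROVED**: the cuspidal torsion points of the model punctured torus `𝔼 = T ∖ {0}`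
are dense in `𝔼` ("Since the torsion points of (b) are dense in `E^top`", p. 59) — the six
`[N]`-diagram sub-nodes (b).1–(b).6 and (c).1 being theorems.
[cite: MochizukiAbsTopIII2015, Corollary 2.7 (c) p.59] -/
theorem cuspidalTorsionPointsDenseModel_holds :
    Literature.AnabelianGeometry.AbsoluteAnabelian.HolomorphicEllipticCuspidalization.CuspidalTorsionPointsDenseModel :=
  cuspidalTorsionPointsDenseModel_of_subnodes nsmulCovIsFiniteEtale_holds nsmulCovIsMorphism_holds
    nsmulDeckAbelianTransitive_holds nsmulImmIsMorphism_holds nsmulImmComplement_holds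
    nsmulCoholomorphic_holds torsionPointsDense_holds

/-- The named fact `TorsionPointsDenseUniqueGroupLaw` of Cor 2.7 (c) (density ∧ uniqueness of the
extending topological group law) follows from the two remaining sub-nodes (c).4
`PuncturedEllipticCurveModel` (⇐ the uniformization of genus-one surfaces, sub-node (c).3) and (c).5
`CuspidalTorsionPointsTransport`; everything at the model is a theorem.
[cite: MochizukiAbsTopIII2015, Corollary 2.7 (c) p.59] -/
theorem torsionPointsDenseUniqueGroupLaw_of_model_transport (h₁ : PuncturedEllipticCurveModel)
    (h₂ : CuspidalTorsionPointsTransport) :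
    Literature.AnabelianGeometry.AbsoluteAnabelian.TorsionPointsDenseUniqueGroupLaw :=
  torsionPointsDenseUniqueGroupLaw_of_subnodes h₁ h₂ cuspidalTorsionPointsDenseModel_holds

end HolomorphicEllipticCuspidalization

end Literature.AnabelianGeometry.AbsoluteAnabelian

end
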